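import Literature.Geometry.Riemannian.CylinderChartScalarPrinted
import Literature.Geometry.Riemannian.NormalFormSliceCalculus
import Literature.Geometry.Riemannian.NormalFormSpaceDerivatives
import Literature.Geometry.Lorentzian.CoordCylinderDeformationPointwise
import HarnessLib

/-!
# The deformed cylinder has positive scalar curvature, I: the `C`-normalisation region

Topic `Literature/Geometry/Riemannian`. A brick (K5d-A of the notes) of the proof of the named
fact `Literature.Geometry.Riemannian.BarHanke2023_thm27_umbilicNormalForm` (Bär–Hanke, §3,
Thm. 27). For the deformed generalized cylinder `G'` (`CylinderNormalFormMetric.lean`), read in a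
chart through `CylinderNormalFormChart.normalFormComponents_eq`, at a time `t` where the second
cutoff `χ` vanishes to second order (the region `t ≥ √δ` of Bär–Hanke's proof, where
`G'` is the interpolation `g_t + a(t)(g₀ + tġ₀ − Ct²g₀ − g_t)` of Prop. 23 with the
logarithmic cutoff `a`), the pointwise estimate `MetricCoord.stepA_pointwise` applies and gives

  `scal_{G'}(z, t) ≥ scal_G(z, t) − 8500 n² b⁸ (1 + C)(t + η) + a(t) (C n − 4 n b²)`

(`regionA_scalarCurvature_lower_bound`), where `b` bounds the chart data of `G` (two space and
two time derivatives of the slice components, their inverse, and the Taylor remainders in `t`)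
and `|t ȧ(t)|, |t² ä(t)| ≤ η`. The time derivatives of the deformed slices come from
`NormalFormSliceCalculus.lean`, the space derivatives from `NormalFormSpaceDerivatives.lean`, and
both scalar curvatures are converted by the printed form of Bär–Hanke's formula (9)
(`cyl_scalarCurvature_eq_coord_printed`). Everything is proved; no definitions, no named facts
(D-0026).

## References

* C. Bär, B. Hanke, *Boundary conditions for scalar curvature*, arXiv:2012.09127, §3, (9),
  Prop. 23, proof of Thm. 27. [BarHanke2023]
-/

noncomputable section

set_option maxSynthPendingDepth 3

open Bundle Set Filter Function Metric TopologicalSpace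
open scoped Manifold ContDiff Topology

namespace Literature.Geometry.Riemannian

open Literature.Geometry.Lorentzian
open Literature.Geometry.Lorentzian.PseudoRiemannianMetric
open Literature.Geometry.Lorentzian.MetricCoord

section Vector

/-- A vector inequality used three times: if `‖X t − X 0 − t Ẋ‖ ≤ b t²` and `‖X 0‖ ≤ b`, then
`‖(1 − θ) X t + θ(1 − Ct²) X 0 + θ t Ẋ + 0 − X t‖ ≤ 2 b (1 + C) t²` for `0 ≤ θ ≤ 1`, `0 ≤ C`.
[folklore] -/
theorem norm_regionA_combo_sub_le {W : Type*} [NormedAddCommGroup W] [NormedSpace ℝ W]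
    {Xt X0 Xd Z : W} {b θ C t : ℝ} (hb : 0 ≤ b) (hθ0 : 0 ≤ θ) (hθ1 : θ ≤ 1) (hC : 0 ≤ C)
    (hT : ‖Xt - X0 - t • Xd‖ ≤ b * t ^ 2) (h0 : ‖X0‖ ≤ b) (hZ : Z = 0) :
    ‖(1 - θ) • Xt + (θ * (1 - C * t ^ 2)) • X0 + (θ * t) • Xd + Z - Xt‖ ≤
      2 * b * (1 + C) * t ^ 2 := by
  have hid : (1 - θ) • Xt + (θ * (1 - C * t ^ 2)) • X0 + (θ * t) • Xd + Z - Xt =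
      (-θ) • (Xt - X0 - t • Xd) + (-(θ * C * t ^ 2)) • X0 := by
    rw [hZ]; module
  rw [hid]
  have h1 : ‖(-θ) • (Xt - X0 - t • Xd)‖ ≤ θ * (b * t ^ 2) := by
    rw [norm_smul, Real.norm_eq_abs, abs_neg, abs_of_nonneg hθ0]; gcongr
  have h2 : ‖(-(θ * C * t ^ 2)) • X0‖ ≤ θ * C * t ^ 2 * b := by
    rw [norm_smul, Real.norm_eq_abs, abs_neg, abs_of_nonneg (by positivity)]; gcongr
  calc _ ≤ θ * (b * t ^ 2) + θ * C * t ^ 2 * b := norm_add_le_of_le h1 h2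
    _ = θ * (b * (1 + C) * t ^ 2) := by ring
    _ ≤ 1 * (b * (1 + C) * t ^ 2) := by gcongr
    _ ≤ 2 * b * (1 + C) * t ^ 2 := by nlinarith [sq_nonneg t, mul_nonneg hb hC]

end Vector

variable {E' : Type*} [NormedAddCommGroup E'] [InnerProductSpace ℝ E'] [FiniteDimensional ℝ E']
  {N : Type*} [TopologicalSpace N] [ChartedSpace E' N] [IsManifold 𝓘(ℝ, E') ∞ N]
  (G G' : PseudoRiemannianMetric (𝓘(ℝ, E').prod 𝓘(ℝ, ℝ)) ∞ (E' × ℝ)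
    (TangentSpace (𝓘(ℝ, E').prod 𝓘(ℝ, ℝ)) : N × ℝ → Type _)) [G.HasLeviCivita] [G'.HasLeviCivita]
  {ψ : OpenPartialHomeomorph N E'}
  (hG : G.IsRiemannian) (hG' : G'.IsRiemannian)
  (hcyl : ∀ (p : N × ℝ) (v w : TangentSpace (𝓘(ℝ, E').prod 𝓘(ℝ, ℝ)) p),
    G.val p v w = G.val p ((v.1, 0) : TangentSpace (𝓘(ℝ, E').prod 𝓘(ℝ, ℝ)) p)
      ((w.1, 0) : TangentSpace (𝓘(ℝ, E').prod 𝓘(ℝ, ℝ)) p) + v.2 * w.2)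
  (hcyl' : ∀ (p : N × ℝ) (v w : TangentSpace (𝓘(ℝ, E').prod 𝓘(ℝ, ℝ)) p),
    G'.val p v w = G'.val p ((v.1, 0) : TangentSpace (𝓘(ℝ, E').prod 𝓘(ℝ, ℝ)) p)
      ((w.1, 0) : TangentSpace (𝓘(ℝ, E').prod 𝓘(ℝ, ℝ)) p) + v.2 * w.2)
  (hψ : ψ ∈ IsManifold.maximalAtlas 𝓘(ℝ, E') ∞ N)
  (F : E' → ℝ → E' →L[ℝ] E' →L[ℝ] ℝ)
  (hF : ∀ (y : E') (s : ℝ), F y s = MaxAtlasChart.metricRepr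
    (G.inducedMetric (fun x : N ↦ ((x, s) : N × ℝ))
      (contMDiff_pullbackBilin_holds (I := 𝓘(ℝ, E').prod 𝓘(ℝ, ℝ)) (M := N × ℝ)
        (I' := 𝓘(ℝ, E')) (N := N))
      (isSpacelikeImmersion_cylSlice G hG s)) hψ y)
  (F' : E' → ℝ → E' →L[ℝ] E' →L[ℝ] ℝ)
  (hF' : ∀ (y : E') (s : ℝ), F' y s = MaxAtlasChart.metricRepr
    (G'.inducedMetric (fun x : N ↦ ((x, s) : N × ℝ))
      (contMDiff_pullbackBilin_holds (I := 𝓘(ℝ, E').prod 𝓘(ℝ, ℝ)) (M := N × ℝ)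
        (I' := 𝓘(ℝ, E')) (N := N))
      (isSpacelikeImmersion_cylSlice G' hG' s)) hψ y)

include hcyl hcyl' hF hF'

set_option maxSynthPendingDepth 4 in
set_option synthInstance.maxHeartbeats 400000 in
set_option maxHeartbeats 4000000 in
/-- **Region A lower bound** (Bär–Hanke, proof of Thm. 27 with Prop. 23): at a time `t ∈ (0, 1]`
where `χ(t) = χ̇(t) = χ̈(t) = 0`, with `0 ≤ a(t) ≤ 1`, `|t ȧ(t)| ≤ η`, `|t² ä(t)| ≤ η ≤ 1`, the
smallness conditions of `stepA_pointwise`, and chart bounds `b` for `G` at `(p, t)`,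
`scal_{G'}(ψ⁻¹p, t) ≥ scal_G(ψ⁻¹p, t) − 8500 n² b⁸ (1+C)(t+η) + a(t)(C n − 4 n b²)`.
[cite: BarHanke2023, §3, Prop. 23 and proof of Thm. 27] -/
theorem regionA_scalarCurvature_lower_bound
    {μ : N → ℝ} {a χ : ℝ → ℝ} {C b η t : ℝ} (ha : ContDiff ℝ ∞ a) (hχ : ContDiff ℝ ∞ χ)
    (hFF' : ∀ (p : MaxAtlasChart.target ψ) (s : ℝ), F' p s = (1 - a s) • F p s +
      (a s * (1 - (C * s ^ 2 + 2 * μ (ψ.symm p) * χ s))) • F p 0 +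
      (a s * (s - χ s)) • deriv (fun σ : ℝ ↦ F p σ) 0)
    {F₁ : E' → ℝ → E' →L[ℝ] E' →L[ℝ] E' →L[ℝ] ℝ}
    (hF₁ : ∀ (y : E') (s : ℝ), F₁ y s =
      (fderiv ℝ (fun q : E' × ℝ ↦ F q.1 q.2) (y, s)).comp (ContinuousLinearMap.inl ℝ E' ℝ))
    {F₂ : E' → ℝ → E' →L[ℝ] E' →L[ℝ] E' →L[ℝ] E' →L[ℝ] ℝ}
    (hF₂ : ∀ (y : E') (s : ℝ), F₂ y s =
      (fderiv ℝ (fun q : E' × ℝ ↦ F₁ q.1 q.2) (y, s)).comp (ContinuousLinearMap.inl ℝ E' ℝ))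
    (hχt : χ t = 0) (hχ' : deriv χ t = 0) (hχ'' : deriv (deriv χ) t = 0)
    (ha0 : 0 ≤ a t) (ha1 : a t ≤ 1) (ha' : |deriv a t| * t ≤ η)
    (ha'' : |deriv (deriv a) t| * t ^ 2 ≤ η)
    (hb : 1 ≤ b) (hC : 0 ≤ C) (hη0 : 0 ≤ η) (hη1 : η ≤ 1) (ht0 : 0 < t) (ht1 : t ≤ 1)
    (hsmall₁ : 4 * b ^ 2 * (1 + C) * t ^ 2 ≤ 1) (hsmall₂ : (1 + C) * t ≤ 1)
    (hsmall₃ : 40 * b ^ 2 * t ≤ 1)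
    (p : MaxAtlasChart.target ψ)
    (hs : ‖sharpAt (fun y ↦ F y t) p‖ ≤ b) (h1 : ‖F₁ p t‖ ≤ b) (h2 : ‖F₂ p t‖ ≤ b)
    (hF00 : ‖F p 0‖ ≤ b) (hFd : ‖deriv (fun s : ℝ ↦ F p s) t‖ ≤ b)
    (hFdd : ‖deriv (deriv (fun s : ℝ ↦ F p s)) t‖ ≤ b)
    (hL0 : ‖F p t - F p 0‖ ≤ b * |t|)
    (hL1 : ‖deriv (fun s : ℝ ↦ F p s) t - deriv (fun s : ℝ ↦ F p s) 0‖ ≤ b * |t|)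
    (hT0 : ‖F p t - F p 0 - t • deriv (fun s : ℝ ↦ F p s) 0‖ ≤ b * t ^ 2)
    (h10 : ‖F₁ p 0‖ ≤ b) (hT1 : ‖F₁ p t - F₁ p 0 - t • deriv (F₁ p) 0‖ ≤ b * t ^ 2)
    (h20 : ‖F₂ p 0‖ ≤ b) (hT2 : ‖F₂ p t - F₂ p 0 - t • deriv (F₂ p) 0‖ ≤ b * t ^ 2) :
    G.scalarCurvature (ψ.symm p, t)
        - 8500 * (Module.finrank ℝ E') ^ 2 * b ^ 8 * (1 + C) * (t + η)
        + a t * (C * Module.finrank ℝ E' - 4 * Module.finrank ℝ E' * b ^ 2) ≤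
      G'.scalarCurvature (ψ.symm p, t) := by
  have hb0 : 0 ≤ b := zero_le_one.trans hb
  have htabs : |t| = t := abs_of_pos ht0
  have hU : IsOpen ψ.target := ψ.open_target
  have hx : (p : E') ∈ ψ.target := p.2
  -- the two metric families
  have hPm : IsMetricOn (fun y ↦ F y t) ψ.target :=
    (isMetricFamilyOn_cylComponents G hG hψ F hF).isMetricOn t (mem_univ _)
  have hQm : IsMetricOn (fun y ↦ F' y t) ψ.target :=
    (isMetricFamilyOn_cylComponents G' hG' hψ F' hF').isMetricOn t (mem_univ _)
  have hFs : ContDiffOn ℝ ∞ (fun q : E' × ℝ ↦ F q.1 q.2) (ψ.target ×ˢ univ) :=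
    contDiffOn_cylComponents G hG hψ F hF
  have hF₁s : ContDiffOn ℝ ∞ (fun q : E' × ℝ ↦ F₁ q.1 q.2) (ψ.target ×ˢ univ) :=
    contDiffOn_family₁ hU hFs hF₁
  -- ### time derivatives of the deformed slice at `p`
  have hfC : ContDiff ℝ ∞ (fun s : ℝ ↦ F p s) := contDiff_cylComponents_right G hG hψ F hF p
  have hg : (fun s : ℝ ↦ F' p s) = fun s ↦ (1 - a s) • F p s +
      (a s * (1 - (C * s ^ 2 + 2 * μ (ψ.symm p) * χ s))) • F p 0 +
      (a s * (s - χ s)) • deriv (fun σ : ℝ ↦ F p σ) 0 := funext (hFF' p)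
  have hQ1 : deriv (fun s : ℝ ↦ F' p s) t = deriv (fun s : ℝ ↦ F p s) t +
      deriv a t • (F p 0 + t • deriv (fun σ : ℝ ↦ F p σ) 0 - (C * t ^ 2) • F p 0 - F p t) +
      a t • (deriv (fun σ : ℝ ↦ F p σ) 0 - (2 * C * t) • F p 0 - deriv (fun s : ℝ ↦ F p s) t) := by
    rw [hg]
    exact deriv_normalFormSlice_of_regionA hfC ha hχ hχt hχ'
  have hQ2 : deriv (deriv (fun s : ℝ ↦ F' p s)) t = deriv (deriv (fun s : ℝ ↦ F p s)) t +
      (deriv (deriv a) t • (F p 0 + t • deriv (fun σ : ℝ ↦ F p σ) 0 - (C * t ^ 2) • F p 0 - F p t) +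
        (2 * deriv a t) • (deriv (fun σ : ℝ ↦ F p σ) 0 - (2 * C * t) • F p 0 -
          deriv (fun s : ℝ ↦ F p s) t)) +
      a t • (-deriv (deriv (fun s : ℝ ↦ F p s)) t - (2 * C) • F p 0) := by
    rw [hg]
    exact deriv_deriv_normalFormSlice_of_regionA hfC ha hχ hχt hχ' hχ''
  -- ### space derivatives at `p`
  have hEq : EqOn (fun y ↦ F' y t) (fun y ↦ (1 - a t) • F y t + (a t * (1 - C * t ^ 2)) • F y 0 +
      (a t * t) • deriv (F y) 0 + (0 : ℝ) • (fun _ : E' ↦ (0 : E' →L[ℝ] E' →L[ℝ] ℝ)) y)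
      ψ.target := by
    intro y hy
    have h := hFF' ⟨y, hy⟩ t
    simp only [hχt, mul_zero, add_zero, sub_zero] at h
    simp only [zero_smul, add_zero]
    exact h
  have hH : ContDiffOn ℝ ∞ (fun _ : E' ↦ (0 : E' →L[ℝ] E' →L[ℝ] ℝ)) ψ.target := contDiffOn_const
  have hD1 := fderiv_combo hU hFs hF₁ hH hEq hx
  have hEq1 := eqOn_fderiv_combo hU hFs hF₁ hH hEq
  have hH1 : ContDiffOn ℝ ∞ (fderiv ℝ (fun _ : E' ↦ (0 : E' →L[ℝ] E' →L[ℝ] ℝ))) ψ.target :=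
    hH.fderiv_of_isOpen hU le_rfl
  have hD2 := fderiv_combo (F := F₁) (F₁ := F₂) hU hF₁s hF₂ hH1 hEq1 hx
  have hP1 : fderiv ℝ (fun y ↦ F y t) p = F₁ p t := fderiv_slice₁ hU hFs hF₁ hx t
  have hP2 : fderiv ℝ (fderiv ℝ (fun y ↦ F y t)) p = F₂ p t := by
    have hev : fderiv ℝ (fun y ↦ F y t) =ᶠ[𝓝 (p : E')] fun y ↦ F₁ y t := by
      filter_upwards [hU.mem_nhds hx] with y hy
      exact fderiv_slice₁ hU hFs hF₁ hy t
    rw [hev.fderiv_eq]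
    exact fderiv_slice₁ hU hF₁s hF₂ hx t
  have hZ1 : fderiv ℝ (fun _ : E' ↦ (0 : E' →L[ℝ] E' →L[ℝ] ℝ)) p = 0 := by simp
  have hZ2 : fderiv ℝ (fderiv ℝ (fun _ : E' ↦ (0 : E' →L[ℝ] E' →L[ℝ] ℝ))) p = 0 := by simp
  -- ### the `d`-hypotheses of step A
  have hd0 : ‖F' p t - F p t‖ ≤ 2 * b * (1 + C) * t ^ 2 := by
    have h := hEq hx
    simp only at h
    rw [h]
    exact norm_regionA_combo_sub_le hb0 ha0 ha1 hC hT0 hF00 (zero_smul ℝ _)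
  have hd1 : ‖fderiv ℝ (fun y ↦ F' y t) p - fderiv ℝ (fun y ↦ F y t) p‖ ≤
      2 * b * (1 + C) * t ^ 2 := by
    rw [hD1, hP1, hZ1, smul_zero]
    exact norm_regionA_combo_sub_le hb0 ha0 ha1 hC hT1 h10 rfl
  have hd2 : ‖fderiv ℝ (fderiv ℝ (fun y ↦ F' y t)) p - fderiv ℝ (fderiv ℝ (fun y ↦ F y t)) p‖ ≤
      2 * b * (1 + C) * t ^ 2 := by
    rw [hD2, hP2, hZ2, smul_zero]
    exact norm_regionA_combo_sub_le hb0 ha0 ha1 hC hT2 h20 rfl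
  -- ### the time-derivative hypotheses of step A
  have hC1 : 1 ≤ 1 + C := by linarith
  have hw : ‖F p 0 + t • deriv (fun σ : ℝ ↦ F p σ) 0 - (C * t ^ 2) • F p 0 - F p t‖ ≤
      b * (1 + C) * t ^ 2 := by
    have hid : F p 0 + t • deriv (fun σ : ℝ ↦ F p σ) 0 - (C * t ^ 2) • F p 0 - F p t =
        -(F p t - F p 0 - t • deriv (fun s : ℝ ↦ F p s) 0) + (-(C * t ^ 2)) • F p 0 := by module
    rw [hid]
    have h2' : ‖(-(C * t ^ 2)) • F p 0‖ ≤ C * t ^ 2 * b := by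
      rw [norm_smul, Real.norm_eq_abs, abs_neg, abs_of_nonneg (by positivity)]; gcongr
    calc _ ≤ b * t ^ 2 + C * t ^ 2 * b := norm_add_le_of_le (by rwa [norm_neg]) h2'
      _ = b * (1 + C) * t ^ 2 := by ring
  have hwd : ‖deriv (fun σ : ℝ ↦ F p σ) 0 - (2 * C * t) • F p 0 - deriv (fun s : ℝ ↦ F p s) t‖ ≤
      2 * b * (1 + C) * t := by
    have hid : deriv (fun σ : ℝ ↦ F p σ) 0 - (2 * C * t) • F p 0 - deriv (fun s : ℝ ↦ F p s) t =
        -(deriv (fun s : ℝ ↦ F p s) t - deriv (fun s : ℝ ↦ F p s) 0) + (-(2 * C * t)) • F p 0 := by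
      module
    rw [hid]
    have h2' : ‖(-(2 * C * t)) • F p 0‖ ≤ 2 * C * t * b := by
      rw [norm_smul, Real.norm_eq_abs, abs_neg, abs_of_nonneg (by positivity)]; gcongr
    have h1' : ‖-(deriv (fun s : ℝ ↦ F p s) t - deriv (fun s : ℝ ↦ F p s) 0)‖ ≤ b * t := by
      calc _ = ‖deriv (fun s : ℝ ↦ F p s) t - deriv (fun s : ℝ ↦ F p s) 0‖ := norm_neg _
        _ ≤ b * |t| := hL1
        _ = b * t := by rw [htabs]
    calc _ ≤ b * t + 2 * C * t * b := norm_add_le_of_le h1' h2'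
      _ = b * (1 + 2 * C) * t := by ring
      _ ≤ 2 * b * (1 + C) * t := by nlinarith [mul_nonneg hb0 ht0.le]
  have hdh : ‖deriv (fun s : ℝ ↦ F' p s) t - deriv (fun s : ℝ ↦ F p s) t‖ ≤ 4 * b * (1 + C) * t := by
    rw [hQ1, add_assoc, add_sub_cancel_left]
    have hA : ‖deriv a t • (F p 0 + t • deriv (fun σ : ℝ ↦ F p σ) 0 - (C * t ^ 2) • F p 0 - F p t)‖ ≤
        b * (1 + C) * t := by
      rw [norm_smul, Real.norm_eq_abs]
      calc |deriv a t| * ‖F p 0 + t • deriv (fun σ : ℝ ↦ F p σ) 0 - (C * t ^ 2) • F p 0 - F p t‖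
          ≤ |deriv a t| * (b * (1 + C) * t ^ 2) := by gcongr
        _ = (|deriv a t| * t) * (b * (1 + C) * t) := by ring
        _ ≤ η * (b * (1 + C) * t) := by gcongr
        _ ≤ 1 * (b * (1 + C) * t) := by gcongr
        _ = b * (1 + C) * t := one_mul _
    have hB : ‖a t • (deriv (fun σ : ℝ ↦ F p σ) 0 - (2 * C * t) • F p 0 - deriv (fun s : ℝ ↦ F p s) t)‖ ≤
        2 * b * (1 + C) * t := by
      rw [norm_smul, Real.norm_eq_abs, abs_of_nonneg ha0]
      calc a t * ‖deriv (fun σ : ℝ ↦ F p σ) 0 - (2 * C * t) • F p 0 - deriv (fun s : ℝ ↦ F p s) t‖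
          ≤ 1 * (2 * b * (1 + C) * t) := by gcongr
        _ = 2 * b * (1 + C) * t := one_mul _
    calc _ ≤ b * (1 + C) * t + 2 * b * (1 + C) * t := norm_add_le_of_le hA hB
      _ ≤ 4 * b * (1 + C) * t := by nlinarith [mul_nonneg (mul_nonneg hb0 (zero_le_one.trans hC1)) ht0.le, hC1]
  have hr : ‖deriv (deriv a) t • (F p 0 + t • deriv (fun σ : ℝ ↦ F p σ) 0 - (C * t ^ 2) • F p 0 - F p t) +
      (2 * deriv a t) • (deriv (fun σ : ℝ ↦ F p σ) 0 - (2 * C * t) • F p 0 -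
        deriv (fun s : ℝ ↦ F p s) t)‖ ≤ 6 * η * b * (1 + C) := by
    have hA : ‖deriv (deriv a) t • (F p 0 + t • deriv (fun σ : ℝ ↦ F p σ) 0 - (C * t ^ 2) • F p 0 -
        F p t)‖ ≤ η * (b * (1 + C)) := by
      rw [norm_smul, Real.norm_eq_abs]
      calc |deriv (deriv a) t| * ‖F p 0 + t • deriv (fun σ : ℝ ↦ F p σ) 0 - (C * t ^ 2) • F p 0 - F p t‖
          ≤ |deriv (deriv a) t| * (b * (1 + C) * t ^ 2) := by gcongr
        _ = (|deriv (deriv a) t| * t ^ 2) * (b * (1 + C)) := by ring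
        _ ≤ η * (b * (1 + C)) := by gcongr
    have hB : ‖(2 * deriv a t) • (deriv (fun σ : ℝ ↦ F p σ) 0 - (2 * C * t) • F p 0 -
        deriv (fun s : ℝ ↦ F p s) t)‖ ≤ 4 * (η * (b * (1 + C))) := by
      rw [norm_smul, Real.norm_eq_abs, abs_mul, abs_of_pos (by norm_num : (0 : ℝ) < 2)]
      calc 2 * |deriv a t| * ‖deriv (fun σ : ℝ ↦ F p σ) 0 - (2 * C * t) • F p 0 -
            deriv (fun s : ℝ ↦ F p s) t‖
          ≤ 2 * |deriv a t| * (2 * b * (1 + C) * t) := by gcongr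
        _ = 4 * ((|deriv a t| * t) * (b * (1 + C))) := by ring
        _ ≤ 4 * (η * (b * (1 + C))) := by gcongr
    calc _ ≤ η * (b * (1 + C)) + 4 * (η * (b * (1 + C))) := norm_add_le_of_le hA hB
      _ = 5 * η * b * (1 + C) := by ring
      _ ≤ 6 * η * b * (1 + C) := by nlinarith [mul_nonneg (mul_nonneg hη0 hb0) (zero_le_one.trans hC1)]
  have hA₀ : ‖F p 0 - F p t‖ ≤ 3 * b * t := by
    rw [norm_sub_rev]
    calc ‖F p t - F p 0‖ ≤ b * |t| := hL0
      _ = b * t := by rw [htabs]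
      _ ≤ 3 * b * t := by nlinarith [mul_nonneg hb0 ht0.le]
  have hhddm : ‖(0 : E' →L[ℝ] E' →L[ℝ] ℝ)‖ ≤ b := by rw [norm_zero]; exact hb0
  have h1' : ‖fderiv ℝ (fun y ↦ F y t) p‖ ≤ b := by rw [hP1]; exact h1
  have h2' : ‖fderiv ℝ (fderiv ℝ (fun y ↦ F y t)) p‖ ≤ b := by rw [hP2]; exact h2
  -- ### step A
  have key := stepA_pointwise hPm hQm hx hb ht0 ht1 hC hη0 ha0 hsmall₁ hsmall₂ hsmall₃ hs h1' h2'
    (hh := deriv (fun s : ℝ ↦ F p s) t) (hh' := deriv (fun s : ℝ ↦ F' p s) t)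
    (hdd := deriv (deriv (fun s : ℝ ↦ F p s)) t) (hddm := 0) (A₀ := F p 0)
    (r := deriv (deriv a) t • (F p 0 + t • deriv (fun σ : ℝ ↦ F p σ) 0 - (C * t ^ 2) • F p 0 - F p t) +
      (2 * deriv a t) • (deriv (fun σ : ℝ ↦ F p σ) 0 - (2 * C * t) • F p 0 -
        deriv (fun s : ℝ ↦ F p s) t))
    hFd hFdd hhddm hd0 hd1 hd2 hdh hr hA₀
  -- ### the printed formula (9) for `G` and `G'`
  have hSG := cyl_scalarCurvature_eq_coord_printed G hG hcyl hψ F hF p t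
  have hSG' := cyl_scalarCurvature_eq_coord_printed G' hG' hcyl' hψ F' hF' p t
  have hQ2' : deriv (fun s ↦ deriv (fun σ : ℝ ↦ F' p σ) s) t =
      deriv (deriv (fun s : ℝ ↦ F p s)) t +
      (deriv (deriv a) t • (F p 0 + t • deriv (fun σ : ℝ ↦ F p σ) 0 - (C * t ^ 2) • F p 0 - F p t) +
        (2 * deriv a t) • (deriv (fun σ : ℝ ↦ F p σ) 0 - (2 * C * t) • F p 0 -
          deriv (fun s : ℝ ↦ F p s) t)) +
      a t • (-deriv (deriv (fun s : ℝ ↦ F p s)) t - 0 - (2 * C) • F p 0) := by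
    rw [sub_zero]; exact hQ2
  have hP2' : deriv (fun s ↦ deriv (fun σ : ℝ ↦ F p σ) s) t = deriv (deriv (fun s : ℝ ↦ F p s)) t := rfl
  rw [hSG, hSG', hQ2', hP2']
  linarith [key]

end Literature.Geometry.Riemannian

end
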